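import Summits.QuantumFields.YangMills.Theorems.LangevinControlUVOSLegsAtWeakCouplingCInheritedAmplitudeGatesDefs
import Summits.QuantumFields.YangMills.Theorems.LangevinControlUVOSLegsFromFemtoAndGapStubLower
import HarnessLib

/-!
# Stub `stub_lowerI` of line `inherited-amplitude-gates` (crux `OSLegsAtWeakCouplingC`, stmt-QuantumFields-16207):
# the two-point half of `LowerBounds` from `FBL` + the windowed floor (L) of `FC2I`

Helper file for the registered stub `stub_lowerI : … → FBL G r a → FC2I G r a → FC3 G r a → LowerBounds G r a` of
the skeleton `Cruxes/OSLegsAtWeakCouplingC/Lines/inherited_amplitude_gates.lean`: the landed two-point half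
`StubLower.lowerBounds_twoPoint` of `stub_lower` (line `dlr-collar-transfer`) re-run with the INHERITED package `FC2I`
in place of `FC2`.  The physical scale is no longer chosen inside growth clauses but TAKEN from `FC2I`'s windowed
clause (L): with `ℓ = min ℓ₁ ℓ₂`, `D = ℓ/100`, call (L) with `K_c = 8C₁²/D⁸ + 1`, `t = ℓ/100`, getting a window
`0 < s₁ < s₂ ≤ t`, a collar `κ₃ s₂ ≤ t` and a floor `c₂ ≥ K_c s₂⁸`, i.e. `c₂/s₂⁸ > 8C₁²/D⁸`.

* `pair_floorI`: every pair `x, y` read by the reflected bump / the bump (physical separation in `[s₁, s₂]`,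
  `pair_separation_thin`) has torus covariance `≥ (c₂/(2 s₂⁸)) a⁸`: the windowed floor `kerCov ≥ c₂/ν⁸ ≥ (c₂/s₂⁸) a⁸`
  inside the cube of radius `R` around `x` (`cube_radius_general` with `T = κ₃ s₂`), FBL's boundary law at depth
  `≥ D/a` (`boundary_of_depth`) and the law of total covariance (`cov_pair_lower`, `half_signal`);
* `lowerBoundsI_twoPoint`: the THIN bump at height `h = (s₁+s₂)/4` above the time-zero plane, plateau radius
  `ρ = (s₂−s₁)/16`, support radius `2ρ` (so that reflected/direct pairs have separation in
  `(2h − 4ρ, 2h + 4ρ) ⊆ [s₁, s₂]` and positive time), Riemann mass of the two plateaux (`pow_le_sum_box`), summation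
  (`mul_sum_mul_sum_le`); `ε = (c₂/(2 s₂⁸)) (ρ/2)⁸`.
-/

set_option autoImplicit false

noncomputable section

open scoped SchwartzMap BigOperators
open MeasureTheory Filter Topology Metric
open Literature.MathematicalPhysics.QuantumFieldTheory Literature.MathematicalPhysics.QuantumLattice
open Literature.MathematicalPhysics.AQFT Literature.Probability.LatticeModels
open Summit.QuantumFields.YangMills.Cruxes.OSLegsFromFemtoAndGap.DlrCollarTransfer
open Summit.QuantumFields.YangMills.Cruxes.OSLegsFromFemtoAndGap.DlrCollarTransfer.StubLower
open Summit.QuantumFields.YangMills.Theorems.OSLegsFromFemtoAndGap.StubLower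

namespace Summit.QuantumFields.YangMills.Cruxes.OSLegsAtWeakCouplingC.InheritedAmplitudeGates.StubLowerI

/-! ### Real-arithmetic bookkeeping (kept out of the main proofs' heartbeat budget) -/

/-- The windowed floor `c₂ ≤ ν⁸ κ` at a separation `ν α ≤ s₂` gives `κ ≥ (c₂/s₂⁸) α⁸`. [folklore] -/
theorem floor_of_window {c₂ ν α s₂ κ : ℝ} (hc₂ : 0 ≤ c₂) (hν : 0 < ν) (hα : 0 < α)
    (hνs : ν * α ≤ s₂) (hlow : c₂ ≤ ν ^ 8 * κ) : c₂ / s₂ ^ 8 * α ^ 8 ≤ κ := by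
  have h1 : c₂ / s₂ ^ 8 * α ^ 8 ≤ c₂ / (ν * α) ^ 8 * α ^ 8 := by
    refine mul_le_mul_of_nonneg_right ?_ (by positivity)
    exact div_le_div_of_nonneg_left hc₂ (by positivity) (pow_le_pow_left₀ (by positivity) hνs 8)
  have h2 : c₂ / (ν * α) ^ 8 * α ^ 8 = c₂ / ν ^ 8 := by
    field_simp
  rw [h2] at h1
  refine h1.trans ?_
  rw [div_le_iff₀ (by positivity)]
  exact hlow.trans_eq (mul_comm _ _)

/-- Signal minus boundary: `M α⁸ - 4(C₁(α/D)⁴)² ≥ (M/2) α⁸` once `4C₁²/D⁸ ≤ M/2` (`half_signal` with unit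
floor constant). [folklore] -/
theorem half_signalI {M C₁ D α cov : ℝ} (hD : 0 < D) (hα : 0 < α) (hMC : 4 * C₁ ^ 2 / D ^ 8 ≤ M / 2)
    (hcov : M * α ^ 8 - 4 * (C₁ * (α / D) ^ 4) * (C₁ * (α / D) ^ 4) ≤ cov) : M / 2 * α ^ 8 ≤ cov := by
  have h := half_signal (c₂ := 1) (M := M) (cov := cov) hD hα (by rwa [one_mul]) (by rwa [one_mul])
  rwa [one_mul] at h

/-- Constants bookkeeping for the two-point scale: with `ℓ ≤ min ℓ₁ ℓ₂`, `D = ℓ/100`, `0 < s₂ ≤ ℓ/100`, collar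
`k s₂ ≤ ℓ/100`, `α ≤ ℓ/100`, the cube is femto and fits in every torus with `ℓ ≤ α L`. [folklore] -/
theorem femto_budgetI {ℓ ℓ₁ ℓ₂ s₂ k α : ℝ} {L : ℕ} (hℓ₁ : ℓ ≤ ℓ₁) (hℓ₂ : ℓ ≤ ℓ₂)
    (hs₂ : s₂ ≤ ℓ / 100) (hs0 : 0 < s₂) (hk0 : 0 ≤ k) (hk : k * s₂ ≤ ℓ / 100) (hα : α ≤ ℓ / 100)
    (hL : ℓ ≤ α * L) :
    2 * (k * s₂ + ℓ / 100 + s₂) + 7 * α ≤ ℓ₁ ∧ 2 * (k * s₂ + ℓ / 100 + s₂) + 7 * α ≤ ℓ₂ ∧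
      k * s₂ + ℓ / 100 + s₂ + 4 * α ≤ α * L := by
  have hks : 0 ≤ k * s₂ := mul_nonneg hk0 hs0.le
  refine ⟨by linarith, by linarith, by linarith⟩

/-- **Pair geometry, thin window.** If `α x` is within `ρ₀` of `-(h e₀)` and `α y` within `ρ₀` of `h e₀`
(`0 ≤ h`) then the physical separation `‖y - x‖ α` lies in `(2h - 2ρ₀, 2h + 2ρ₀)`. [folklore] -/
theorem pair_separation_thin {α h ρ₀ : ℝ} (hα : 0 < α) (hh : 0 ≤ h) (x y : Fin 4 → ℤ)
    (hx : ‖α • siteToE x + EuclideanSpace.single 0 h‖ < ρ₀)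
    (hy : ‖α • siteToE y - EuclideanSpace.single 0 h‖ < ρ₀) :
    2 * h - 2 * ρ₀ < ‖siteToE (y - x)‖ * α ∧ ‖siteToE (y - x)‖ * α < 2 * h + 2 * ρ₀ := by
  have hx' : ‖α • siteToE x - (-EuclideanSpace.single 0 h)‖ < ρ₀ := by rwa [sub_neg_eq_add]
  obtain ⟨-, h1, h2⟩ := pair_separation_centres hα x y hx' hy
  have hn : ‖(EuclideanSpace.single 0 h : EuclideanSpace ℝ (Fin 4)) - -EuclideanSpace.single 0 h‖ =
      2 * h := by
    rw [sub_neg_eq_add, ← two_smul ℝ, norm_smul, norm_single_zero, Real.norm_eq_abs, abs_of_pos two_pos,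
      abs_of_nonneg hh]
  rw [hn] at h1 h2
  exact ⟨h1, h2⟩

section PairFloor

variable (G : Type) [Group G] [TopologicalSpace G] [IsTopologicalGroup G] [CompactSpace G]
  [MeasurableSpace G] [BorelSpace G] (r : LatticeRep G) (a : ℝ → ℝ)

/-- **The per-pair covariance floor from FBL + the windowed clause (L) of `FC2I`.**  For a coupling past the
FBL / window thresholds with `a(β)` small, a torus covering the femto cube, and a pair `x, y` read at height
`∓h` with radius `ρ₀` (`s₁ ≤ 2h − 2ρ₀`, `2h + 2ρ₀ ≤ s₂`): `Cov(dens x, dens y) ≥ (c₂/(2 s₂⁸)) a⁸`. [folklore] -/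
theorem pair_floorI
    {C₁ β₁ ℓ₁ : ℝ} {p : ℝ → ℝ} (hC₁ : 0 ≤ C₁)
    (hFBL : ∀ β : ℝ, β₁ ≤ β → ∀ (c : Fin 4 → ℤ) (b : ℕ), (b : ℝ) * a β ≤ ℓ₁ →
      ∀ (η : LGConfig 4 G) (x : Fin 4 → ℤ), 2 ≤ depth c b x →
        |kerE G r β c b η (dens G r x) - p β| ≤ C₁ / (depth c b x : ℝ) ^ 4)
    {β₃ ℓ₂ s₁ s₂ c₂ : ℝ} {κ₃ n₀ : ℕ}
    (hWin : ∀ β : ℝ, β₃ ≤ β → ∀ (c : Fin 4 → ℤ) (b : ℕ), (b : ℝ) * a β ≤ ℓ₂ →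
      ∀ (η : LGConfig 4 G) (x y : Fin 4 → ℤ), (n₀ : ℝ) ≤ ‖siteToE (y - x)‖ →
        (κ₃ : ℝ) * ‖siteToE (y - x)‖ ≤ depth c b x → (κ₃ : ℝ) * ‖siteToE (y - x)‖ ≤ depth c b y →
        s₁ ≤ ‖siteToE (y - x)‖ * a β → ‖siteToE (y - x)‖ * a β ≤ s₂ →
          c₂ ≤ ‖siteToE (y - x)‖ ^ 8 * kerCov G r β c b η (dens G r x) (dens G r y))
    {D : ℝ} (hD : 0 < D) (hs₁ : 0 < s₁) (hMC : 4 * C₁ ^ 2 / D ^ 8 ≤ c₂ / s₂ ^ 8 / 2)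
    {β : ℝ} (hβ₁ : β₁ ≤ β) (hβ₃ : β₃ ≤ β) (hα : 0 < a β) (hαn₀ : (n₀ : ℝ) * a β ≤ s₁)
    (hfem₁ : 2 * ((κ₃ : ℝ) * s₂ + D + s₂) + 7 * a β ≤ ℓ₁)
    (hfem₂ : 2 * ((κ₃ : ℝ) * s₂ + D + s₂) + 7 * a β ≤ ℓ₂)
    {L : ℕ} (hL : (κ₃ : ℝ) * s₂ + D + s₂ + 4 * a β ≤ a β * L)
    {hgt ρ₀ : ℝ} (hlo : s₁ ≤ 2 * hgt - 2 * ρ₀) (hhi : 2 * hgt + 2 * ρ₀ ≤ s₂)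
    (x y : Fin 4 → ℤ) (hx : ‖a β • siteToE x + EuclideanSpace.single 0 hgt‖ < ρ₀)
    (hy : ‖a β • siteToE y - EuclideanSpace.single 0 hgt‖ < ρ₀) :
    c₂ / s₂ ^ 8 / 2 * a β ^ 8 ≤ torusE G r β L (fun U => dens G r x U * dens G r y U)
      - torusE G r β L (dens G r x) * torusE G r β L (dens G r y) := by
  have hρ₀ : 0 < ρ₀ := (norm_nonneg _).trans_lt hx
  have hhgt : 0 ≤ hgt := by linarith only [hlo, hs₁, hρ₀]
  obtain ⟨hν1, hν2⟩ := pair_separation_thin hα hhgt x y hx hy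
  have hν1' : s₁ < ‖siteToE (y - x)‖ * a β := by linarith only [hlo, hν1]
  have hν2' : ‖siteToE (y - x)‖ * a β < s₂ := by linarith only [hhi, hν2]
  have hs₂ : 0 < s₂ := by linarith only [hs₁, hν1', hν2']
  have hν0 : 0 < ‖siteToE (y - x)‖ := by
    by_contra h
    push Not at h
    nlinarith
  have hc₂ : 0 ≤ c₂ := by
    have h1 : 0 ≤ c₂ / s₂ ^ 8 / 2 := le_trans (by positivity) hMC
    have h2 : c₂ = c₂ / s₂ ^ 8 / 2 * (2 * s₂ ^ 8) := by field_simp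
    rw [h2]; positivity
  have hκ₃ : (0 : ℝ) ≤ κ₃ := Nat.cast_nonneg _
  have hT0 : 0 ≤ (κ₃ : ℝ) * s₂ := mul_nonneg hκ₃ hs₂.le
  -- the cube of radius `R` around `x`
  obtain ⟨R, hR1, hRL, hRν, hfem⟩ :=
    cube_radius_general (T := (κ₃ : ℝ) * s₂) (νb := s₂) hα hT0 hD hs₂.le hL
  obtain ⟨hνR, hbud⟩ := hRν ‖siteToE (y - x)‖ hν2'.le
  have hyx : ∀ j, |y j - x j| + 1 ≤ (R : ℤ) := fun j => by
    have h1 := abs_sub_le_norm_siteToE x y j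
    have h3 : ((|y j - x j| + 1 : ℤ) : ℝ) ≤ R := by push_cast; linarith only [h1, hνR]
    exact_mod_cast h3
  -- depths of `x` and `y`
  have hdx : (R : ℝ) + 1 - ‖siteToE (y - x)‖ ≤ (depth (fun j => x j - R) (2 * R + 1) x : ℝ) := by
    have := le_depth_cube x x R (t := 0) (fun j => by simp)
    linarith only [this, hν0]
  have hdy : (R : ℝ) + 1 - ‖siteToE (y - x)‖ ≤ (depth (fun j => x j - R) (2 * R + 1) y : ℝ) :=
    le_depth_cube x y R fun j => abs_sub_le_norm_siteToE x y j
  -- the depth budget `(κ₃ s₂ + D)/α + 3 ≤ R + 1 - ν`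
  have hP : 0 ≤ ((κ₃ : ℝ) * s₂ + D) / a β := div_nonneg (by linarith only [hT0, hD]) hα.le
  have hKν : (κ₃ : ℝ) * ‖siteToE (y - x)‖ ≤ (R : ℝ) + 1 - ‖siteToE (y - x)‖ := by
    have h1 : ‖siteToE (y - x)‖ ≤ s₂ / a β := by rw [le_div_iff₀ hα]; exact hν2'.le
    have h2 : (κ₃ : ℝ) * ‖siteToE (y - x)‖ ≤ (κ₃ : ℝ) * (s₂ / a β) :=
      mul_le_mul_of_nonneg_left h1 hκ₃
    have h3 : (κ₃ : ℝ) * (s₂ / a β) ≤ ((κ₃ : ℝ) * s₂ + D) / a β := by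
      rw [← mul_div_assoc]; exact div_le_div_of_nonneg_right (by linarith only [hD]) hα.le
    linarith only [h2, h3, hbud]
  have hDa : D / a β ≤ (R : ℝ) + 1 - ‖siteToE (y - x)‖ := by
    have : D / a β ≤ ((κ₃ : ℝ) * s₂ + D) / a β :=
      div_le_div_of_nonneg_right (by linarith only [hT0]) hα.le
    linarith only [this, hbud]
  have h2 : (2 : ℝ) ≤ (R : ℝ) + 1 - ‖siteToE (y - x)‖ := by linarith only [hP, hbud]
  -- the cube is femto
  have hb : ((2 * R + 1 : ℕ) : ℝ) * a β ≤ 2 * ((κ₃ : ℝ) * s₂ + D + s₂) + 7 * a β := by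
    push_cast; exact hfem
  -- (L): the conditional covariance floor, every exterior
  have hn₀ν : (n₀ : ℝ) ≤ ‖siteToE (y - x)‖ :=
    le_of_mul_le_mul_right (hαn₀.trans hν1'.le) hα
  have hfloor : ∀ η, c₂ / s₂ ^ 8 * a β ^ 8 ≤
      kerCov G r β (fun j => x j - R) (2 * R + 1) η (dens G r x) (dens G r y) := fun η =>
    floor_of_window hc₂ hν0 hα hν2'.le
      (hWin β hβ₃ (fun j => x j - R) (2 * R + 1) (hb.trans hfem₂) η x y hn₀ν (hKν.trans hdx)
        (hKν.trans hdy) hν1'.le hν2'.le)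
  -- FBL: the boundary law at depth `≥ D/α`
  have hh : ∀ z : Fin 4 → ℤ,
      (R : ℝ) + 1 - ‖siteToE (y - x)‖ ≤ (depth (fun j => x j - R) (2 * R + 1) z : ℝ) →
      ∀ η, |kerE G r β (fun j => x j - R) (2 * R + 1) η (dens G r z) - p β| ≤
        C₁ * (a β / D) ^ 4 := by
    intro z hz η
    have h2z : 2 ≤ depth (fun j => x j - R) (2 * R + 1) z := by
      have : (2 : ℝ) ≤ depth (fun j => x j - R) (2 * R + 1) z := h2.trans hz
      exact_mod_cast this
    exact boundary_of_depth hC₁ hD hα (by linarith only [h2, hz]) (hDa.trans hz)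
      (hFBL β hβ₁ _ _ (hb.trans hfem₁) η z h2z)
  -- law of total covariance
  exact half_signalI hD hα hMC
    (cov_pair_lower G r β x y R L hRL hR1 hyx (hh x hdx) (hh y hdy) hfloor)

end PairFloor

/-- **The two-point half of `LowerBounds` from `FBL` + `FC2I`** (sub-goal of `stub_lowerI`): a real positive-time
bump `v` and `ε > 0` with `Q2(θv, v) ≥ ε` on every large torus at every large coupling; the window, collar and
floor are those of `FC2I`'s clause (L) called with `K_c = 8C₁²/D⁸ + 1`, `t = ℓ/100`. [folklore] -/
theorem lowerBoundsI_twoPoint : ∀ (G : Type) [Group G] [TopologicalSpace G] [IsTopologicalGroup G] [CompactSpace G] [MeasurableSpace G] [BorelSpace G] (r : LatticeRep G) (a : ℝ → ℝ), (∀ β, 0 < a β) → Filter.Tendsto a Filter.atTop (nhds 0) → FBL G r a → FC2I G r a → ∃ (v : 𝓢(EuclideanSpace ℝ (Fin 4), ℝ)) (ε β₅ Λ₅ : ℝ), tsupport v ⊆ {y : EuclideanSpace ℝ (Fin 4) | 0 < y 0} ∧ 0 < ε ∧ ∀ β : ℝ, β₅ ≤ β → ∀ L : ℕ, Λ₅ ≤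 a β * L → ε ≤ Q2 G r β L (a β) (thetaTest 4 v) v := by
  intro G _ _ _ _ _ _ r a hapos hlim hFBL hFC2I
  obtain ⟨C₁, β₁, ℓ₁, p, hℓ₁, hC₁, hFBLc⟩ := hFBL
  obtain ⟨β₂, ℓ₂, C₂, κ₂, n₀, hℓ₂, hn₀, -, hWin⟩ := hFC2I
  -- the constants
  obtain ⟨ℓ, hℓ⟩ : ∃ ℓ : ℝ, ℓ = min ℓ₁ ℓ₂ := ⟨_, rfl⟩
  have hℓ0 : 0 < ℓ := by rw [hℓ]; exact lt_min hℓ₁ hℓ₂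
  have hℓℓ₁ : ℓ ≤ ℓ₁ := hℓ ▸ min_le_left _ _
  have hℓℓ₂ : ℓ ≤ ℓ₂ := hℓ ▸ min_le_right _ _
  obtain ⟨D, hD⟩ : ∃ D : ℝ, D = ℓ / 100 := ⟨_, rfl⟩
  have hD0 : 0 < D := by rw [hD]; positivity
  -- the window, collar and floor of clause (L)
  obtain ⟨s₁, s₂, c₂, β₃, κ₃, hs₁, hs₁₂, hs₂t, hκ₃t, hKc, hWinc⟩ :=
    hWin (8 * C₁ ^ 2 / D ^ 8 + 1) (ℓ / 100) (by positivity)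
  have hs₂ : 0 < s₂ := hs₁.trans hs₁₂
  have hKc' : 8 * C₁ ^ 2 / D ^ 8 + 1 ≤ c₂ / s₂ ^ 8 := by
    rw [le_div_iff₀ (by positivity)]; exact hKc
  have h84 : 8 * C₁ ^ 2 / D ^ 8 = 2 * (4 * C₁ ^ 2 / D ^ 8) := by ring
  have h40 : (0 : ℝ) ≤ 4 * C₁ ^ 2 / D ^ 8 := by positivity
  have hMC : 4 * C₁ ^ 2 / D ^ 8 ≤ c₂ / s₂ ^ 8 / 2 := by linarith only [hKc', h84, h40]
  have hε0 : 0 < c₂ / s₂ ^ 8 / 2 := by linarith only [hKc', h84, h40]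
  -- the thin bump: centre height `hgt = (s₁ + s₂)/4`, plateau radius `ρ = (s₂ - s₁)/16`, support radius `2ρ`
  obtain ⟨hgt, hhgt⟩ : ∃ hgt : ℝ, hgt = (s₁ + s₂) / 4 := ⟨_, rfl⟩
  obtain ⟨ρ, hρ⟩ : ∃ ρ : ℝ, ρ = (s₂ - s₁) / 16 := ⟨_, rfl⟩
  have hρ0 : 0 < ρ := by rw [hρ]; linarith only [hs₁₂]
  have hhgt0 : 0 < hgt := by rw [hhgt]; linarith only [hs₁, hs₂]
  have hlo : s₁ ≤ 2 * hgt - 2 * (2 * ρ) := by rw [hhgt, hρ]; linarith only [hs₁₂]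
  have hhi : 2 * hgt + 2 * (2 * ρ) ≤ s₂ := by rw [hhgt, hρ]; linarith only [hs₁₂]
  have h2ρ : 2 * ρ < hgt := by rw [hρ, hhgt]; linarith only [hs₁, hs₁₂]
  obtain ⟨v, hv0, -, hvone, hvsupp, hvts⟩ :=
    exists_bump_schwartz (EuclideanSpace.single 0 hgt) (ρ := ρ) hρ0
  -- small spacings
  have hn₀0 : (0 : ℝ) < n₀ := by exact_mod_cast hn₀
  obtain ⟨β₀, hβ₀⟩ := exists_of_tendsto_atTop_nhds_zero hlim
    (a₀ := min (ℓ / 100) (min (s₁ / n₀) (ρ / 2))) (by positivity)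
  refine ⟨v, c₂ / s₂ ^ 8 / 2 * (ρ / 2) ^ 8, max β₀ (max β₁ β₃), ℓ, ?_, by positivity, ?_⟩
  · -- positive time
    rw [hvts]
    intro y hy
    rw [mem_closedBall, dist_eq_norm] at hy
    have h1 := abs_apply_le_norm (y - EuclideanSpace.single 0 hgt) 0
    have h2 : |y 0 - hgt| ≤ 2 * ρ := by simpa using h1.trans hy
    show 0 < y 0
    have := (abs_le.1 h2).1
    linarith only [this, h2ρ]
  intro β hβ L hL
  have hββ₀ : β₀ ≤ β := le_of_max_le_left hβ
  have hββ₁ : β₁ ≤ β := le_of_max_le_left (le_of_max_le_right hβ)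
  have hββ₃ : β₃ ≤ β := le_of_max_le_right (le_of_max_le_right hβ)
  have hα := hapos β
  have hαa₀ := hβ₀ β hββ₀
  have hαℓ : a β ≤ ℓ / 100 := (hαa₀.trans_le (min_le_left _ _)).le
  have hαn : a β ≤ s₁ / n₀ := (hαa₀.trans_le ((min_le_right _ _).trans (min_le_left _ _))).le
  have hαρ : a β ≤ ρ / 2 := (hαa₀.trans_le ((min_le_right _ _).trans (min_le_right _ _))).le
  have hαn₀ : (n₀ : ℝ) * a β ≤ s₁ := by
    rw [le_div_iff₀ hn₀0] at hαn; linarith only [hαn]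
  have hκ₃0 : (0 : ℝ) ≤ κ₃ := Nat.cast_nonneg _
  obtain ⟨hfem₁, hfem₂, hL'⟩ :=
    femto_budgetI (L := L) hℓℓ₁ hℓℓ₂ hs₂t hs₂ hκ₃0 hκ₃t hαℓ hL
  rw [← hD] at hfem₁ hfem₂ hL'
  -- the per-pair floor
  have key : ∀ x y : Fin 4 → ℤ, thetaTest 4 v (a β • siteToE x) ≠ 0 → v (a β • siteToE y) ≠ 0 →
      c₂ / s₂ ^ 8 / 2 * a β ^ 8 ≤ torusE G r β L (fun U => dens G r x U * dens G r y U)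
        - torusE G r β L (dens G r x) * torusE G r β L (dens G r y) := by
    intro x y hx hy
    refine pair_floorI G r a hC₁ hFBLc hWinc hD0 hs₁ hMC hββ₁ hββ₃ hα hαn₀ hfem₁ hfem₂ hL' hlo hhi
      x y ?_ ?_
    · rw [thetaTest_apply] at hx
      have := hvsupp _ hx
      rwa [dist_eq_norm, norm_timeReflection_sub_single] at this
    · have := hvsupp _ hy
      rwa [dist_eq_norm] at this
  -- Riemann mass of the two plateaux
  have hcover : ∀ j, |(EuclideanSpace.single (0 : Fin 4) hgt : EuclideanSpace ℝ (Fin 4)) j| + ρ ≤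
      a β * L := fun j => by
    have h1 : |(EuclideanSpace.single (0 : Fin 4) hgt : EuclideanSpace ℝ (Fin 4)) j| ≤ hgt := by
      rw [PiLp.single_apply]
      split_ifs
      · rw [abs_of_pos hhgt0]
      · rw [abs_zero]; exact hhgt0.le
    have h3 : hgt + ρ ≤ ℓ := by rw [hhgt, hρ]; linarith only [hs₂t, hs₁, hs₁₂, hℓ0]
    linarith only [h1, h3, hL]
  have hSy : (ρ / (2 * a β)) ^ 4 ≤ ∑ y ∈ box 4 L, v (a β • siteToE y) :=
    pow_le_sum_box hv0 hα (fun z hz => hvone z hz) (by linarith only [hαρ]) hcover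
  have hSx : (ρ / (2 * a β)) ^ 4 ≤ ∑ x ∈ box 4 L, thetaTest 4 v (a β • siteToE x) := by
    refine pow_le_sum_box (p := -EuclideanSpace.single 0 hgt) (fun z => ?_) hα
      (fun z hz => ?_) (by linarith only [hαρ]) (fun j => by simpa using hcover j)
    · rw [thetaTest_apply]; exact hv0 _
    · rw [thetaTest_apply]
      refine hvone _ ?_
      rwa [dist_eq_norm, norm_timeReflection_sub_single, ← sub_neg_eq_add, ← dist_eq_norm]
  -- summation
  have hsum := mul_sum_mul_sum_le (B := box 4 L) (κ := c₂ / s₂ ^ 8 / 2 * a β ^ 8)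
    (f := fun x => thetaTest 4 v (a β • siteToE x)) (g := fun y => v (a β • siteToE y))
    (C := fun x y => torusE G r β L (fun U => dens G r x U * dens G r y U)
      - torusE G r β L (dens G r x) * torusE G r β L (dens G r y))
    (fun x => by rw [thetaTest_apply]; exact hv0 _) (fun y => hv0 _) key
  unfold Q2
  refine le_trans ?_ hsum
  have hα0 : a β ≠ 0 := hα.ne'
  have hpos : (0 : ℝ) ≤ (ρ / (2 * a β)) ^ 4 := by positivity
  calc c₂ / s₂ ^ 8 / 2 * (ρ / 2) ^ 8
      = c₂ / s₂ ^ 8 / 2 * a β ^ 8 * ((ρ / (2 * a β)) ^ 4 * (ρ / (2 * a β)) ^ 4) := by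
        field_simp
    _ ≤ _ := mul_le_mul_of_nonneg_left (mul_le_mul hSx hSy hpos (hpos.trans hSx))
        (mul_nonneg hε0.le (by positivity))

end Summit.QuantumFields.YangMills.Cruxes.OSLegsAtWeakCouplingC.InheritedAmplitudeGates.StubLowerI

end
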